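import Summits.QuantumFields.YangMills.Theorems.BalabanUVNodesN06SectBStepUParKnitRecord

/-!
# Balaban UV-stability nodes, N06 [B9] Sect. B — «K2-G-KNIT-REC-KC»: THE KNIT SECT.-B STEP OF RECORD IN THE KNIT CERTIFICATE's OWN CURRENCY — the `hBK` fold of
# «KC» ∕ «KE» with the GUARDED knit Thm 3.11 unit `hunitA` DISCHARGED from the certificate's displayed positivity `hΔAK` (row 17) through its class bridge `hP1`,
# and the plaquette threshold read from the certificate's index-keyed `hKplK`

[B9] = T. Bałaban, *Propagators for lattice gauge theories in a background field*, Commun. Math. Phys. **99** (1985) 389–434 [`Balaban1985BackgroundPropagators`];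
[B8] = T. Bałaban, *Averaging operations for lattice gauge theories*, Commun. Math. Phys. **98** (1985) 17–51 [`Balaban1985Averaging`]; [4] = [`Balaban1984PropagatorsII`].

statement-level skeleton of published theorems with citation tags; proofs where landed; nothing here is a claim about the Yang–Mills mass gap

THE PRINT.  Thm 3.4 p. 400 (the Sect.-B step for the pair `(U, U′)` of (3.35)–(3.37)); Thm 3.11 p. 416 («Δ_a … positive … hence invertible», (3.24)–(3.25) p. 395);
(3.19) p. 393 (the averaging's transporters are those of [B8] (52)–(53)); Thms 3.2∕3.3 pp. 398–399.

WHAT (seat dag-n06-c gen 27; cell `pub-ymgap`, HUMAN RULING D-0062, Track A node N06).  `…N06SectBStepUParKnitRecord.sectBStepUPar_knitRecord` (gen 26, ✓) is the knit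
certificate's `hBK` binder shape `h32 → h33 → SectBStepUPar … (C37KY …) …` with ONE guarded law still displayed: the knit Thm 3.11 unit
`hunitA : MInv ≤ M → 0 < α₀ → M·α₀ ≤ aInv → (bg9YC 𝕄 SU(N) extraYPb x).Reg335 c35Y α₀ U → IsUnit Δ_a^Q(U; 𝔮_rec, parKnitY, G′)`.  The certificate «KC»
(dag-n06-d, `…N06AtOpsYSectEStKnitPairKC.b9LeafXUR_opsYSectESt_knit_pairKC`, ✓) DISPLAYS row 17 as `hΔAK : MR ≤ M → 0 < α₀ → M·α₀ ≤ q.a₁∕c → (bg9YR 𝕄 SU(N) R₁ R₂ x).Reg335 c α₀ U →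
IsSymmTr Δ_a^Q ∧ PosDefTr Δ_a^Q` over its generic regime pair `(R₁, R₂)` with the class bridge `hP1 : ClassIncl (regYP335 𝕄 SU(N)) c35Y R₁ c`, and the plaquette threshold
index-keyed, `hKplK : ∀ i a, 0 ≤ a → a ≤ aK → K_pl(i, a)·L⁴ < α₀K`.  THIS FILE: ★★★ `sectBStepUPar_knitRecordKC` = `sectBStepUPar_knitRecord` with `hunitA` DISCHARGED —
`(bg9YC … extraYPb x).Reg335 c35Y α₀ U` ⟹ (`B9SectBCodedClassR.classIncl_regC335Pb_regYPb335`, then `hP1`, exactly «KC»'s own `h1U`) `(bg9YR … R₁ R₂ x).Reg335 c α₀ U` ⟹ (`hΔAK`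
at `MR ≤ MInv`, `aInv ≤ aR`, `aR` standing for «KC»'s `q.a₁ ∕ c`) `PosDefTr Δ_a^Q(U)` ⟹ (`B9Thm311ReadingCoords.isUnit_of_posDefTr`, print's «positive, hence invertible»)
`IsUnit Δ_a^Q(U)` — and with `hKpl` READ from `hKplK` on `a ≤ aInv ≤ aK`.  Every other binder is `sectBStepUPar_knitRecord`'s, the α-window spelled at «KC»'s `α₀K`.

CONSUMER RECIPE («KE₂», after «KA ed.2» re-keys the class token `C37GY → C37KY` over `B9LeafXCodedKnitUParHX`):
`hBK := fun h32 h33 => sectBStepUPar_knitRecordKC θ.toStage3Params Mstar f bR ιB C38 CqK MK aInv hN hι M₂ hM₂ hrepr hcR hcL hCqK MInv aW hMInv haInv haW c hP1 MR aR hΔAK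
hMRI haIR hαK hαQ hα8 hKplK haIK hϱ′ hϱ hsmall′ hc₃′ hϱ′1 hE hdX hsmall hc₃ hMd mN hnbr hMr h32 h33` with `(aR := q.a₁ ∕ c)` (e.g. `aInv := q.a₁ ∕ c`, `haIR := le_rfl`,
`haIK := hqaK`, `haInv := div_pos q_OK.a₁_pos hc`); NEW displays w.r.t. «KC»: `hN : N ≤ 25` (LOCATED-RANGE), `hαQ hα8` (the knit (3.15) size ∕ Lemma-2.1 windows, stronger than
`hαK3 hαK2`), dag-n06-l's [B8] Prop. 7 window `ϱ′ ϱ` (`hsmall′ hc₃′ hϱ′1 hE hdX hsmall hc₃`), the basis data, `CqK MK MInv aW` — jointly inhabited with the rest by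
`…N06SectBKnitWindow.knitSectBWindow_inhabited` (gen 26, ✓).

HONEST SCOPE.  Instantiation ∕ bookkeeping of landed theorems; conditional on `hΔAK`, `h32`, `h33`, the numerics and `N ≦ 25`; a HELPER by key 27364 — NOT the discharge of
any N06 obligation; count-neutral; nothing continuum ∕ OS ∕ mass gap ∕ Clay.  2026-08-30/31.
-/

noncomputable section

namespace Summit.QuantumFields.YangMills.BalabanUVNodes.N06SectBStepUParKnitRecordKC

open scoped Matrix Matrix.Norms.L2Operator
open Literature.MathematicalPhysics.QuantumFieldTheory.Balaban1983to89
open Literature.MathematicalPhysics.QuantumFieldTheory.Balaban1983to89.Node00 (SiteY BlkY FBondY IBondY CfgY SiteParY GAQY GpY XY deltaAQY deltaPrimeAY parSymY parBY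
  kernelFamilyS kernelFamilyB Stage3Params)
open Literature.MathematicalPhysics.QuantumFieldTheory.Balaban1983to89.Node00.OpsYQLetter (adjTrY qKnitOfRecord qsKnitOfRecord)
open Literature.MathematicalPhysics.QuantumFieldTheory.Balaban1983to89.Node00 (cqY)
open Literature.MathematicalPhysics.QuantumFieldTheory.Balaban1983to89.B6Ineq2142KLevelV1 (β)
open Literature.MathematicalPhysics.QuantumFieldTheory.Balaban1983to89.B6KLevelCensusIndexV1 (KIdx kGeo)
open Literature.MathematicalPhysics.QuantumFieldTheory.Balaban1983to89.B9PinMembersKLevelV1 (MemberY geo9Y)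
open Literature.MathematicalPhysics.QuantumFieldTheory.Balaban1983to89.B9PinGeometryKLevelV1 (c35Y)
open Literature.MathematicalPhysics.QuantumFieldTheory.Balaban1983to89.B9PinGeometryKLevelV1B (c35Y_le_ten)
open Literature.MathematicalPhysics.QuantumFieldTheory.Balaban1983to89.B9BackgroundsKLevelV1P (bg9KP)
open Literature.MathematicalPhysics.QuantumFieldTheory.Balaban1983to89.B9SectBCodedClassR (RegExtraY bg9YC extraYPb)
open Literature.MathematicalPhysics.QuantumFieldTheory.Balaban1983to89.B9Eq360DeltaPrimeAY (AfldY)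
open Literature.MathematicalPhysics.QuantumFieldTheory.Balaban1983to89.B9SectBGpFrameCodedYR (codingYx)
open Literature.MathematicalPhysics.QuantumFieldTheory.Balaban1983to89.B9SectBCodedReadingsUR (KACU)
open Literature.MathematicalPhysics.QuantumFieldTheory.Balaban1983to89.B9SectBCodedReadingsUParH (KSCUPar SectBStepUPar)
open Literature.MathematicalPhysics.QuantumFieldTheory.Balaban1983to89.B9SectBKerFrameCodedYR (CinvY)
open Literature.MathematicalPhysics.QuantumFieldTheory.Balaban1983to89.B9RWSumsReadsNbr (nbr)
open Literature.MathematicalPhysics.QuantumFieldTheory.Balaban1983to89.B9Eq340TaxiContourLocalityY (rLB)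
open Literature.MathematicalPhysics.QuantumFieldTheory.Balaban1983to89.B9SectBCodedClassKnitY (C37KY)
open Literature.MathematicalPhysics.QuantumFieldTheory.Balaban1983to89.B7Prop2Explicit (unitaryUnits c2')
open Literature.MathematicalPhysics.QuantumFieldTheory.Balaban1983to89.B7Prop2SpecialUnitary (specialUnitaryUnits specialUnitaryUnits_le_unitaryUnits)
open Literature.MathematicalPhysics.QuantumFieldTheory.Balaban1983to89.B7AvgClosedSpecialUnitarySharp (avgClosed_specialUnitary_of_le)
open Literature.MathematicalPhysics.QuantumFieldTheory.Balaban1983to89.B7Prop3Flat (c3)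
open Literature.MathematicalPhysics.QuantumFieldTheory.Balaban1983to89.B7Prop5CplxLevels (epsCplx tauCplx)
open Literature.MathematicalPhysics.QuantumFieldTheory.Balaban1983to89.B9Eq316AveragingTransposeZd (alphaQ)
open Literature.MathematicalPhysics.QuantumFieldTheory.Balaban1983to89.B9C2FormBoxRegimeY (Kpl)
open Literature.MathematicalPhysics.QuantumFieldTheory.Balaban1983to89.B9B8AveragingJunction (parKnitY)
open Literature.MathematicalPhysics.QuantumFieldTheory.Balaban1983to89.B9LeafXCodedKnitUParH (thm33Printed_codedUPar)
open Summit.QuantumFields.YangMills.BalabanUVNodes.N06SectBStepUParKnitFull (sectBStepUPar_knit)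

open Literature.MathematicalPhysics.QuantumFieldTheory.Balaban1983to89.B9BackgroundsKLevelV1R (RegFamY bg9YR regYP335)
open Literature.MathematicalPhysics.QuantumFieldTheory.Balaban1983to89.B9LeafXClassAntitone (ClassIncl)
open Literature.MathematicalPhysics.QuantumFieldTheory.Balaban1983to89.B9SectBCodedClassR (regC335 classIncl_regC335Pb_regYPb335)
open Literature.MathematicalPhysics.QuantumFieldTheory.Balaban1983to89.B9Thm311ReadingCoords (PosDefTr IsSymmTr isUnit_of_posDefTr)
open Literature.MathematicalPhysics.QuantumFieldTheory.Balaban1983to89.B7Prop2Explicit (C0)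
open Summit.QuantumFields.YangMills.BalabanUVNodes.N06SectBStepUParKnitRecord (sectBStepUPar_knitRecord)

variable {N : ℕ} [NeZero N] [Nonempty (Fin N)] (θ : Stage3Params) (Mstar : ℕ)
variable {ι : Type} [Fintype ι] [DecidableEq ι]
variable {J : Type} (f : J → MemberY θ.d₆ θ.ℓ₆ θ.hd' θ.hL' θ.b₀ θ.b₁ Mstar)
  [∀ x : MemberY θ.d₆ θ.ℓ₆ θ.hd' θ.hL' θ.b₀ θ.b₁ Mstar, Fintype (geo9Y x).Site]
  [instDS : ∀ x : MemberY θ.d₆ θ.ℓ₆ θ.hd' θ.hL' θ.b₀ θ.b₁ Mstar, DecidableEq (geo9Y x).Site]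
  [instNE : ∀ x : MemberY θ.d₆ θ.ℓ₆ θ.hd' θ.hL' θ.b₀ θ.b₁ Mstar, Nonempty (geo9Y x).Site]
  (b : Module.Basis ι ℝ (Matrix (Fin N) (Fin N) ℂ)) (ιB : ∀ j : J, BlkY (f j).toKIdx → IBondY (f j).toKIdx)
  (C38 : ∀ j : J, ℝ → CfgY (Matrix (Fin N) (Fin N) ℂ) (f j).toKIdx → AfldY (Matrix (Fin N) (Fin N) ℂ) (f j).toKIdx → Prop)
  (CqK MK aInv : ℝ)

/-- ★★★ **THE KNIT SECT.-B STEP OF RECORD IN THE CERTIFICATE's CURRENCY** — `sectBStepUPar_knitRecord` (`G := SU(N)`, `N ≦ 25`; `c35 := c35Y`; the averaging pair of record;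
`P := extraYPb`; class token `C37KY SU(N) (f j) (ιB j) ((bg9YC … extraYPb (f j)).Reg335 c35Y) (cqY d₆) CqK MK aInv (ϱ′·L³∕3)`) with the guarded knit Thm 3.11 unit `hunitA`
DISCHARGED from the certificate's displayed row-17 law `hΔAK` (symmetry and positivity of `Δ_a^Q(U)` over (3.115)'s `Q` and the knit contours, in the certificate's regime currency
`(R₁, R₂, c)` with `aR` for its `q.a₁∕c`) through its class bridge `hP1` and `isUnit_of_posDefTr` (print: «positive, hence invertible»), on `MR ≤ MInv`, `aInv ≤ aR`; the
plaquette threshold READ from the certificate's index-keyed `hKplK` on `aInv ≤ aK`; the α-window spelled at the certificate's `α₀K`.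
[cite: Balaban1985BackgroundPropagators, Thm 3.4 p.400, Thm 3.11 p.416, (3.24)–(3.25) p.395, (3.19) p.393, (3.35)–(3.37) p.396, Thms 3.2–3.3 pp.398–399; Balaban1985Averaging, Prop. 2 p.26, Prop. 7 p.43; Balaban1984PropagatorsII, Lemma 2.1 p.234] -/
theorem sectBStepUPar_knitRecordKC [NormOneClass (Matrix (Fin N) (Fin N) ℂ)] [FiniteDimensional ℝ (Matrix (Fin N) (Fin N) ℂ)] (hN : N ≤ 25)
    (hι : ∀ (j : J) (s : BlkY (f j).toKIdx), β (f j).toKIdx.hN (f j).toKIdx.D (f j).toKIdx.hk (ιB j s) = s)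
    (M₂ : ℝ) (hM₂ : 0 ≤ M₂) (hrepr : ∀ (v : Matrix (Fin N) (Fin N) ℂ) (j : ι), |b.repr v j| ≤ M₂ * ‖v‖) (hcR : 0 < M₂ * ∑ j, ‖b j‖)
    (hcL : 0 < Real.sqrt (Fintype.card ι) * M₂ * ∑ j, ‖b j‖)
    (hCqK : 0 ≤ CqK) (MInv aW : ℝ) (hMInv : 0 < MInv) (haInv : 0 < aInv) (haW : 0 < aW)
    {R₁ R₂ : RegFamY θ.d₆ θ.ℓ₆ θ.hd' θ.hL' θ.b₀ θ.b₁ Mstar (Matrix (Fin N) (Fin N) ℂ)} (c : ℝ)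
    (hP1 : ClassIncl (regYP335 (Matrix (Fin N) (Fin N) ℂ) (specialUnitaryUnits (Fin N))) c35Y R₁ c) (MR aR : ℝ)
    (hΔAK : ∀ x : MemberY θ.d₆ θ.ℓ₆ θ.hd' θ.hL' θ.b₀ θ.b₁ Mstar, MR ≤ (geo9Y x).M → ∀ α₀ : ℝ, 0 < α₀ → (geo9Y x).M * α₀ ≤ aR →
      ∀ U : (bg9YR (Matrix (Fin N) (Fin N) ℂ) (specialUnitaryUnits (Fin N)) R₁ R₂ x).Cfg, (bg9YR (Matrix (Fin N) (Fin N) ℂ) (specialUnitaryUnits (Fin N)) R₁ R₂ x).Reg335 c α₀ U →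
        IsSymmTr (fun _ => (1 : ℝ)) (deltaAQY x.toKIdx (qKnitOfRecord N θ x.toKIdx) (qsKnitOfRecord N θ x.toKIdx) (parKnitY x.toKIdx) (GpY x.toKIdx (parKnitY x.toKIdx)) U) ∧
          PosDefTr (fun _ => (1 : ℝ)) (deltaAQY x.toKIdx (qKnitOfRecord N θ x.toKIdx) (qsKnitOfRecord N θ x.toKIdx) (parKnitY x.toKIdx) (GpY x.toKIdx (parKnitY x.toKIdx)) U))
    (hMRI : MR ≤ MInv) (haIR : aInv ≤ aR)
    {α₀K aK : ℝ} (hαK : 0 < α₀K) (hαQ : α₀K ≤ alphaQ (θ.d₆ + 1) (θ.ℓ₆ + 1)) (hα8 : 8 * α₀K ≤ c2' (θ.d₆ + 1) (θ.ℓ₆ + 1))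
    (hKplK : ∀ (i : KIdx θ.d₆ θ.ℓ₆ θ.hd' θ.hL' θ.b₀ θ.b₁) (a : ℝ), 0 ≤ a → a ≤ aK → Kpl i a * (kGeo i).L ^ 4 < α₀K) (haIK : aInv ≤ aK)
    {ϱ' ϱ : ℝ} (hϱ' : 0 < ϱ') (hϱ : 0 < ϱ)
    (hsmall' : Real.exp (4 * (800 * (((θ.d₆ + 1 : ℕ) : ℝ) + 1) ^ 2 * (((θ.d₆ + 1 : ℕ) : ℝ) + 4)) * α₀K)
      * (1 + 8 * (131072 * (((θ.d₆ + 1 : ℕ) : ℝ) + 1) ^ 2) * ϱ') ≤ 2)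
    (hc₃' : 2 * ϱ' ≤ c3 (θ.d₆ + 1) (θ.ℓ₆ + 1)) (hϱ'1 : 409600 * (((θ.d₆ + 1 : ℕ) : ℝ) + 1) ^ 2 * ϱ' ≤ 1)
    (hE : epsCplx (θ.d₆ + 1) (θ.ℓ₆ + 1) ϱ' 0 ≤ 1 / 16)
    (hdX : ((θ.d₆ + 1 : ℕ) : ℝ) * (epsCplx (θ.d₆ + 1) (θ.ℓ₆ + 1) ϱ' 0 + tauCplx (θ.d₆ + 1) (θ.ℓ₆ + 1) α₀K 0 ϱ' 0) ≤ 1 / 16)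
    (hsmall : Real.exp (4480 * (((θ.d₆ + 1 : ℕ) : ℝ) + 1) ^ 2 * (((θ.d₆ + 1 : ℕ) : ℝ) + 4) * α₀K + 240000 * (((θ.d₆ + 1 : ℕ) : ℝ) + 1) ^ 3 * ϱ')
      * (1 + 8 * (2097152 * (((θ.d₆ + 1 : ℕ) : ℝ) + 1) ^ 2) * ϱ) ≤ 2)
    (hc₃ : 2 * ϱ ≤ c3 (θ.d₆ + 1) (θ.ℓ₆ + 1) / 4)
    (hMd : 2 * ((θ.d₆ : ℝ) + 1) < MInv) (mN : ℕ) (hnbr : ∀ (j : J) (y' : IBondY (f j).toKIdx), (nbr (geo9Y (f j)) (2 * ((θ.d₆ : ℝ) + 1)) y').card ≤ mN)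
    (hMr : rLB θ.d₆ θ.ℓ₆ + 1 < MInv)
    (h32 : B9.Thm32Printed (θ.d₆ + 1) c35Y (fun j => geo9Y (f j))
      (fun j => bg9YC (Matrix (Fin N) (Fin N) ℂ) (specialUnitaryUnits (Fin N)) (extraYPb (Matrix (Fin N) (Fin N) ℂ) (specialUnitaryUnits (Fin N))) (f j))
      (CinvY (extraYPb (Matrix (Fin N) (Fin N) ℂ) (specialUnitaryUnits (Fin N))) f (specialUnitaryUnits (Fin N)) (fun j => parKnitY (f j).toKIdx)))
    (h33 : B9.Thm33Printed c35Y (fun j => geo9Y (f j))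
      (fun j => bg9YC (Matrix (Fin N) (Fin N) ℂ) (specialUnitaryUnits (Fin N)) (extraYPb (Matrix (Fin N) (Fin N) ℂ) (specialUnitaryUnits (Fin N))) (f j))
      (fun j => kernelFamilyS (f j).toKIdx
        (bg9YC (Matrix (Fin N) (Fin N) ℂ) (specialUnitaryUnits (Fin N)) (extraYPb (Matrix (Fin N) (Fin N) ℂ) (specialUnitaryUnits (Fin N))) (f j)) (fun U => U)
        (GpY (f j).toKIdx (parKnitY (f j).toKIdx)) (parSymY (f j).toKIdx))
      (fun j => kernelFamilyB (f j).toKIdx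
        (bg9YC (Matrix (Fin N) (Fin N) ℂ) (specialUnitaryUnits (Fin N)) (extraYPb (Matrix (Fin N) (Fin N) ℂ) (specialUnitaryUnits (Fin N))) (f j)) (fun U => U)
        (GAQY (f j).toKIdx (qKnitOfRecord N θ (f j).toKIdx) (qsKnitOfRecord N θ (f j).toKIdx) (parKnitY (f j).toKIdx) (GpY (f j).toKIdx (parKnitY (f j).toKIdx)))
        (parBY (f j).toKIdx))) :
    SectBStepUPar (extraYPb (Matrix (Fin N) (Fin N) ℂ) (specialUnitaryUnits (Fin N))) f (θ.d₆ + 1) c35Y (specialUnitaryUnits (Fin N)) b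
      (fun j => parKnitY (f j).toKIdx) (fun j => parSymY (f j).toKIdx)
      (fun j => GAQY (f j).toKIdx (qKnitOfRecord N θ (f j).toKIdx) (qsKnitOfRecord N θ (f j).toKIdx) (parKnitY (f j).toKIdx) (GpY (f j).toKIdx (parKnitY (f j).toKIdx)))
      (fun j => parBY (f j).toKIdx)
      (fun j => C37KY (specialUnitaryUnits (Fin N)) (f j) (ιB j)
        (fun α₀ U => (bg9YC (Matrix (Fin N) (Fin N) ℂ) (specialUnitaryUnits (Fin N)) (extraYPb (Matrix (Fin N) (Fin N) ℂ) (specialUnitaryUnits (Fin N))) (f j)).Reg335 c35Y α₀ U)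
        (cqY θ.d₆) CqK MK aInv (ϱ' * (((θ.ℓ₆ + 1 : ℕ) : ℝ)) ^ 3 / 3))
      C38 (CinvY (extraYPb (Matrix (Fin N) (Fin N) ℂ) (specialUnitaryUnits (Fin N))) f (specialUnitaryUnits (Fin N)) (fun j => parKnitY (f j).toKIdx)) := by
  -- «KC»'s own bridge `h1U`: the coded class of record at `c35Y` lies in the certificate's class `R₁` at `c` (for `0 < α₀`)
  have h1U : ClassIncl (regC335 (Matrix (Fin N) (Fin N) ℂ) (specialUnitaryUnits (Fin N)) (extraYPb (Matrix (Fin N) (Fin N) ℂ) (specialUnitaryUnits (Fin N)))) c35Y R₁ c :=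
    fun x α₀ U hα h => hP1 x α₀ U hα (classIncl_regC335Pb_regYPb335 c35Y c35Y x α₀ U hα h).2
  -- the guarded knit Thm 3.11 unit from the displayed positivity: «positive, hence invertible»
  have hunitA : ∀ j (α₀ : ℝ) (U : CfgY (Matrix (Fin N) (Fin N) ℂ) (f j).toKIdx), MInv ≤ (geo9Y (f j)).M → 0 < α₀ → (geo9Y (f j)).M * α₀ ≤ aInv →
      (bg9YC (Matrix (Fin N) (Fin N) ℂ) (specialUnitaryUnits (Fin N)) (extraYPb (Matrix (Fin N) (Fin N) ℂ) (specialUnitaryUnits (Fin N))) (f j)).Reg335 c35Y α₀ U →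
      IsUnit (deltaAQY (f j).toKIdx (qKnitOfRecord N θ (f j).toKIdx) (qsKnitOfRecord N θ (f j).toKIdx) (parKnitY (f j).toKIdx)
        (GpY (f j).toKIdx (parKnitY (f j).toKIdx)) U) :=
    fun j α₀ U hM hα ha hU => isUnit_of_posDefTr (hΔAK (f j) (hMRI.trans hM) α₀ hα (ha.trans haIR) U (h1U (f j) α₀ U hα hU)).2
  exact sectBStepUPar_knitRecord θ Mstar f b ιB C38 CqK MK aInv hN hι M₂ hM₂ hrepr hcR hcL hCqK MInv aW hMInv haInv haW hαK hαQ hα8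
    (fun j a h0 ha => hKplK (f j).toKIdx a h0 (ha.trans haIK)) hϱ' hϱ hsmall' hc₃' hϱ'1 hE hdX hsmall hc₃ hunitA hMd mN hnbr hMr h32 h33

end Summit.QuantumFields.YangMills.BalabanUVNodes.N06SectBStepUParKnitRecordKC

end
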